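import Mathlib
import HarnessLib
import Summits.Ventures.LatticeQCDFlow.Exactness.SphereLuscherFiniteTimeUniqueness

/-!
# Lüscher's normalisation identity `Ċ_t·∫e^{−tS}dπ̄ = −∫S e^{−tS}dπ̄` for the lattice of site spheres, to all orders in `t` with an explicit remainder: the truncated series solves the flow equation up to `t^{K+1}`, and `Σ_{k≤K} ċ_k t^k = (d/dt)log∫e^{−tS}dπ̄ − t^{K+1}·⟨Σ⟨∂̃S, ∂̃S̃⁽ᴷ⁾⟩⟩_t`

HONEST FRAMING: exact (Metropolis-corrected) sampling algorithms for lattice gauge theory;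
figures of merit are autocorrelation/cost numbers at stated couplings and volumes; no
continuum-physics claim.

Venture `LatticeQCDFlow` (cell pub-lqcd), topic `Exactness`; FANOUT row 7 (`s0-cpn-null`).  NEW WORK
of the cell over the tree's `Exactness/SphereTiltedGreen.lean` (this leg: `sphereLuscherL`,
`∫e^{−tS}𝓛_tF dπ̄ = 0`), `Exactness/SphereLuscherFiniteTimeUniqueness.lean` (this leg: linearity of
`𝓛_t`, `0 < ∫e^{−tS}dπ̄`) and Mathlib's `ProbabilityTheory.mgf` / `cgf` / `Measure.tilted` calculus
(`deriv_mgf`, `deriv_cgf`, `integral_tilted`); nothing is cited as a fact.  Printed counterpart,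
NAMED ONLY: M. Lüscher, Commun. Math. Phys. 293 (2010) 899, §4.2 eqs. (4.5)–(4.10) and §4.3
(4.11)–(4.15): the flow action `S̃_t = Σ_k t^k S̃⁽ᵏ⁾` solves `𝓛_tS̃_t = S + Ċ_t`, and pairing with the
constant function in `L²(e^{−tS})` gives `Ċ_t = −(1,S)_t/(1,1)_t` (4.9), i.e. `C_t = ln ∫D[U]e^{−tS}`
up to an additive constant (4.10).  The tree had the solvability condition order by order INSIDE the
recursion (`SphereLuscherSeriesConstants`: `ċ_{k+1} = 2(d−1)Cov_π̄(S̃⁽ᵏ⁾, S)` for the E–S action,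
`ċ₀ = −S₀`, `ċ₁ = Var_π̄(S)`) and listed "anything at flow time `t > 0`" as NOT CLAIMED.  THIS FILE
proves the finite-`t` statement, for EVERY `C¹` action `S` on `Ω = S(E)^Λ` and EVERY `C²` solution
`(S̃⁽ᵏ⁾, ċ_k)_k` of Lüscher's recursion, with no convergence assumption: the TRUNCATED series
`S̃_t^{≤K} = Σ_{k≤K} t^k S̃⁽ᵏ⁾` solves the flow equation EXACTLY up to the explicit defect
`t^{K+1}Σ_n⟪∂̃_nS, ∂̃_nS̃⁽ᴷ⁾⟫`, and integrating against `e^{−tS}π̄` (where `𝓛_t` has mean zero) gives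
Lüscher's (4.9) with that defect as the only error term, at every real `t` and every order `K`.

## Setting

`E` finite-dimensional real inner product space (`d = dim E`; CP(N−1): `d = 2N`), `Λ` finite,
`π̄ = ⊗_Λ σ̄` (`σ̄ = uniformSphere volume`, probability), configurations `ω : Λ → S(E)` read through
`n ↦ (ω n : E)`; a `C²` LÜSCHER SERIES of `S`: `−Σ∂̃²S̃⁽⁰⁾ = S + ċ₀` and
`−Σ∂̃²S̃⁽ᵏ⁺¹⁾ = −Σ_n⟪∂̃_nS, ∂̃_nS̃⁽ᵏ⁾⟫ + ċ_{k+1}` on `Ω` (the tree's convention since GEN-7).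

## Content

* §1 **`sphereLuscherL_partialSum`** — THE TRUNCATED SERIES SOLVES THE FLOW EQUATION UP TO ORDER
  `K`: `𝓛_t S̃_t^{≤K} = S + Σ_{k≤K} ċ_k t^k + t^{K+1}·Σ_n⟪∂̃_nS, ∂̃_nS̃⁽ᴷ⁾⟫` on `Ω`, every real `t`.
* §2 **`luscher_normalization_truncated`** — LÜSCHER'S (4.9) TO ALL ORDERS WITH REMAINDER:
  `(Σ_{k≤K} ċ_k t^k)·∫e^{−tS}dπ̄ = −∫e^{−tS}S dπ̄ − t^{K+1}·∫e^{−tS}Σ_n⟪∂̃_nS, ∂̃_nS̃⁽ᴷ⁾⟫dπ̄`.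
* §3 THE `log Z` READING (Mathlib's `mgf`/`cgf` of the bounded random variable `−S` on `(Ω, π̄)`):
  `integrableExpSet_neg_action_eq_univ`, `mgf_neg_action_eq` (`Z(t) = ∫e^{−tS}dπ̄ = mgf(−S)(t)`),
  `deriv_mgf_neg_action_eq` (`Z′(t) = −∫e^{−tS}S dπ̄`), **`sphereLuscherL_flow_constant_eq_deriv_cgf`**
  (an EXACT `C²` solution of `𝓛_tF = S + C` at time `t` has `C = (log Z)′(t)` — (4.9) on the nose),
  **`luscher_normalization_truncated_mgf`**
  (`Ċ_t^{≤K}·Z(t) = Z′(t) − t^{K+1}R_K(t)`), **`luscher_normalization_truncated_cgf`**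
  (`Ċ_t^{≤K} = (log Z)′(t) − t^{K+1}R_K(t)/Z(t)`) and **`luscher_normalization_truncated_tilted`**
  (`Ċ_t^{≤K} = −⟨S⟩_t − t^{K+1}⟨Σ_n⟪∂̃_nS, ∂̃_nS̃⁽ᴷ⁾⟫⟩_t` under the tilted probability measure
  `μ_t = e^{−tS}π̄/Z(t)` — eq. (4.9) verbatim, with the truncation defect as the only error).

The sequel `Exactness/SphereLuscherCumulants.lean` extracts the Taylor coefficients: the `ċ_k` satisfy
the moment–cumulant recursion of `−S` under `π̄`, so `ċ_k = κ_{k+1}(−S)/k!` (cumulants) for all `k`.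

NOT CLAIMED: convergence of `Σ_k t^kS̃⁽ᵏ⁾` or smallness of the defect as `K → ∞`; existence of an exact
finite-`t` flow action; anything about the flow map, its Jacobian, autocorrelations or the rung.
-/

noncomputable section

namespace Summit.Ventures.LatticeQCDFlow.Exactness

open Function Set Metric MeasureTheory NormedSpace InnerProductSpace ProbabilityTheory
open scoped RealInnerProductSpace

variable {Λ : Type*} {E : Type*} [NormedAddCommGroup E] [InnerProductSpace ℝ E]
  [FiniteDimensional ℝ E] [Fintype Λ] [DecidableEq Λ]

/-! ## §1 The truncated series solves the flow equation up to order `K` -/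

section Truncated

variable {S : (Λ → E) → ℝ} {St : ℕ → (Λ → E) → ℝ} {c : ℕ → ℝ}

omit [FiniteDimensional ℝ E] [DecidableEq Λ] in
/-- The partial sums `Σ_{k≤K} t^k S̃⁽ᵏ⁾` of a `C²` series are `C²`. -/
theorem contDiff_luscherPartialSum (hSt : ∀ k, ContDiff ℝ 2 (St k)) (t : ℝ) (K : ℕ) :
    ContDiff ℝ 2 (fun z : Λ → E => ∑ k ∈ Finset.range (K + 1), t ^ k * St k z) :=
  ContDiff.sum fun k _ => contDiff_const.mul (hSt k)

/-- `𝓛_t` passes through the partial sums: `𝓛_t(Σ_{k≤K} t^kS̃⁽ᵏ⁾) = Σ_{k≤K} t^k 𝓛_tS̃⁽ᵏ⁾` on `Ω`. -/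
theorem sphereLuscherL_sum_pow_mul (hSt : ∀ k, ContDiff ℝ 2 (St k)) (t : ℝ) (K : ℕ)
    (ω : Λ → sphere (0 : E) 1) :
    sphereLuscherL S t (fun z => ∑ k ∈ Finset.range (K + 1), t ^ k * St k z) (fun m => (ω m : E)) =
      ∑ k ∈ Finset.range (K + 1), t ^ k * sphereLuscherL S t (St k) (fun m => (ω m : E)) := by
  rw [sphereLuscherL_finset_sum t (F := fun k z => t ^ k * St k z) (Finset.range (K + 1))
    (fun k _ => contDiff_const.mul (hSt k)) ω]
  exact Finset.sum_congr rfl fun k _ => sphereLuscherL_const_mul t (hSt k) _ ω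

/-- Order `0` of the recursion through `𝓛_t`: `𝓛_tS̃⁽⁰⁾ = S + ċ₀ + t·Σ_n⟪∂̃_nS, ∂̃_nS̃⁽⁰⁾⟫` on `Ω`. -/
theorem sphereLuscherL_order_zero (t : ℝ)
    (h0 : ∀ ξ : Λ → sphere (0 : E) 1,
      -∑ n, siteLaplacian n (St 0) (fun m => (ξ m : E)) = S (fun m => (ξ m : E)) + c 0)
    (ω : Λ → sphere (0 : E) 1) :
    sphereLuscherL S t (St 0) (fun m => (ω m : E)) = S (fun m => (ω m : E)) + c 0 +
      t * ∑ n, ⟪siteGrad n S (fun m => (ω m : E)), siteGrad n (St 0) (fun m => (ω m : E))⟫ := by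
  rw [sphereLuscherL_apply, h0 ω]

/-- Order `k+1` of the recursion through `𝓛_t`:
`𝓛_tS̃⁽ᵏ⁺¹⁾ = −Σ_n⟪∂̃_nS, ∂̃_nS̃⁽ᵏ⁾⟫ + ċ_{k+1} + t·Σ_n⟪∂̃_nS, ∂̃_nS̃⁽ᵏ⁺¹⁾⟫` on `Ω`. -/
theorem sphereLuscherL_order_succ (t : ℝ)
    (hs : ∀ k, ∀ ξ : Λ → sphere (0 : E) 1,
      -∑ n, siteLaplacian n (St (k + 1)) (fun m => (ξ m : E)) =
        -(∑ n, ⟪siteGrad n S (fun m => (ξ m : E)), siteGrad n (St k) (fun m => (ξ m : E))⟫) +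
          c (k + 1))
    (k : ℕ) (ω : Λ → sphere (0 : E) 1) :
    sphereLuscherL S t (St (k + 1)) (fun m => (ω m : E)) =
      -(∑ n, ⟪siteGrad n S (fun m => (ω m : E)), siteGrad n (St k) (fun m => (ω m : E))⟫) +
        c (k + 1) +
        t * ∑ n, ⟪siteGrad n S (fun m => (ω m : E)), siteGrad n (St (k + 1)) (fun m => (ω m : E))⟫ := by
  rw [sphereLuscherL_apply, hs k ω]

/-- **THE TRUNCATED LÜSCHER SERIES SOLVES THE FLOW EQUATION UP TO ORDER `K`.**  For every `C²`
Lüscher series `(S̃⁽ᵏ⁾, ċ_k)` of `S`, every real `t`, every `K` and every `ω ∈ Ω`: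
`𝓛_t(Σ_{k≤K} t^kS̃⁽ᵏ⁾)(ω) = S(ω) + Σ_{k≤K} ċ_k t^k + t^{K+1}·Σ_n⟪∂̃_nS(ω), ∂̃_nS̃⁽ᴷ⁾(ω)⟫`
— the recursion telescopes; the only defect is the last cross term, of order `t^{K+1}`. -/
theorem sphereLuscherL_partialSum (hSt : ∀ k, ContDiff ℝ 2 (St k))
    (h0 : ∀ ξ : Λ → sphere (0 : E) 1,
      -∑ n, siteLaplacian n (St 0) (fun m => (ξ m : E)) = S (fun m => (ξ m : E)) + c 0)
    (hs : ∀ k, ∀ ξ : Λ → sphere (0 : E) 1,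
      -∑ n, siteLaplacian n (St (k + 1)) (fun m => (ξ m : E)) =
        -(∑ n, ⟪siteGrad n S (fun m => (ξ m : E)), siteGrad n (St k) (fun m => (ξ m : E))⟫) +
          c (k + 1))
    (t : ℝ) (K : ℕ) (ω : Λ → sphere (0 : E) 1) :
    sphereLuscherL S t (fun z => ∑ k ∈ Finset.range (K + 1), t ^ k * St k z) (fun m => (ω m : E)) =
      S (fun m => (ω m : E)) + ∑ k ∈ Finset.range (K + 1), c k * t ^ k +
        t ^ (K + 1) * ∑ n, ⟪siteGrad n S (fun m => (ω m : E)), siteGrad n (St K) (fun m => (ω m : E))⟫ := by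
  rw [sphereLuscherL_sum_pow_mul hSt t K ω]
  induction K with
  | zero =>
    rw [Finset.sum_range_one, Finset.sum_range_one, sphereLuscherL_order_zero t h0 ω]
    ring
  | succ K ih =>
    rw [Finset.sum_range_succ, ih, Finset.sum_range_succ (fun k => c k * t ^ k) (K + 1),
      sphereLuscherL_order_succ t hs K ω]
    ring

end Truncated

/-! ## §2 Lüscher's normalisation identity to all orders, with remainder -/

section Normalisation

variable [MeasurableSpace E] [BorelSpace E] [Nontrivial E]
variable {S : (Λ → E) → ℝ} {St : ℕ → (Λ → E) → ℝ} {c : ℕ → ℝ}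

/-- **LÜSCHER'S NORMALISATION IDENTITY (eq. (4.9)) TO ALL ORDERS IN `t`, WITH AN EXPLICIT REMAINDER.**
For every `C¹` action `S` on `Ω`, every `C²` Lüscher series `(S̃⁽ᵏ⁾, ċ_k)` of `S`, every real `t` and
every order `K`:
`(Σ_{k≤K} ċ_k t^k)·∫e^{−tS}dπ̄ = −∫e^{−tS}S dπ̄ − t^{K+1}·∫e^{−tS}Σ_n⟪∂̃_nS, ∂̃_nS̃⁽ᴷ⁾⟫dπ̄`
(integrate §1 against `e^{−tS}π̄`, under which `𝓛_t` has mean zero).  In words: the constants of the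
series are the Taylor coefficients of `Ċ_t = −⟨S e^{−tS}⟩/⟨e^{−tS}⟩ = (d/dt) log∫e^{−tS}dπ̄`. -/
theorem luscher_normalization_truncated (hS : ContDiff ℝ 1 S) (hSt : ∀ k, ContDiff ℝ 2 (St k))
    (h0 : ∀ ξ : Λ → sphere (0 : E) 1,
      -∑ n, siteLaplacian n (St 0) (fun m => (ξ m : E)) = S (fun m => (ξ m : E)) + c 0)
    (hs : ∀ k, ∀ ξ : Λ → sphere (0 : E) 1,
      -∑ n, siteLaplacian n (St (k + 1)) (fun m => (ξ m : E)) =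
        -(∑ n, ⟪siteGrad n S (fun m => (ξ m : E)), siteGrad n (St k) (fun m => (ξ m : E))⟫) +
          c (k + 1))
    (t : ℝ) (K : ℕ) :
    (∑ k ∈ Finset.range (K + 1), c k * t ^ k) *
        ∫ ω, Real.exp (-(t * S (fun m => ((ω : Λ → sphere (0 : E) 1) m : E))))
          ∂Measure.pi (fun _ : Λ => uniformSphere (volume : Measure E)) =
      -∫ ω, Real.exp (-(t * S (fun m => ((ω : Λ → sphere (0 : E) 1) m : E)))) *
          S (fun m => (ω m : E)) ∂Measure.pi (fun _ : Λ => uniformSphere (volume : Measure E)) -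
        t ^ (K + 1) * ∫ ω, Real.exp (-(t * S (fun m => ((ω : Λ → sphere (0 : E) 1) m : E)))) *
          ∑ n, ⟪siteGrad n S (fun m => (ω m : E)), siteGrad n (St K) (fun m => (ω m : E))⟫
            ∂Measure.pi (fun _ : Λ => uniformSphere (volume : Measure E)) := by
  set μ : Measure (sphere (0 : E) 1) := uniformSphere (volume : Measure E) with hμ
  have h := integral_exp_mul_sphereLuscherL_eq_zero (Λ := Λ) hS (contDiff_luscherPartialSum hSt t K) t
  have hpt : ∀ ω : Λ → sphere (0 : E) 1,
      Real.exp (-(t * S (fun m => (ω m : E)))) *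
          sphereLuscherL S t (fun z => ∑ k ∈ Finset.range (K + 1), t ^ k * St k z)
            (fun m => (ω m : E)) =
        Real.exp (-(t * S (fun m => (ω m : E)))) * S (fun m => (ω m : E)) +
          (∑ k ∈ Finset.range (K + 1), c k * t ^ k) * Real.exp (-(t * S (fun m => (ω m : E)))) +
          t ^ (K + 1) * (Real.exp (-(t * S (fun m => (ω m : E)))) *
            ∑ n, ⟪siteGrad n S (fun m => (ω m : E)), siteGrad n (St K) (fun m => (ω m : E))⟫) :=
    fun ω => by
    rw [sphereLuscherL_partialSum hSt h0 hs t K ω]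
    ring
  simp_rw [hpt] at h
  have hW := continuous_exp_neg_mul_sphereConfig (Λ := Λ) hS.continuous t
  have hi1 : Integrable (fun ω : Λ → sphere (0 : E) 1 =>
      Real.exp (-(t * S (fun m => (ω m : E)))) * S (fun m => (ω m : E))) (Measure.pi fun _ : Λ => μ) :=
    integrable_pi_of_continuous μ (hW.mul (hS.continuous.comp continuous_sphereConfig))
  have hi2 : Integrable (fun ω : Λ → sphere (0 : E) 1 =>
      (∑ k ∈ Finset.range (K + 1), c k * t ^ k) * Real.exp (-(t * S (fun m => (ω m : E)))))
        (Measure.pi fun _ : Λ => μ) := (integrable_pi_of_continuous μ hW).const_mul _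
  have hi3 : Integrable (fun ω : Λ → sphere (0 : E) 1 =>
      t ^ (K + 1) * (Real.exp (-(t * S (fun m => (ω m : E)))) *
        ∑ n, ⟪siteGrad n S (fun m => (ω m : E)), siteGrad n (St K) (fun m => (ω m : E))⟫))
          (Measure.pi fun _ : Λ => μ) :=
    (integrable_pi_of_continuous μ (hW.mul (continuous_finsetSum _ fun n _ =>
      continuous_inner_siteGrad ((hSt K).of_le (by norm_num)) hS n n))).const_mul _
  have hi12 : Integrable (fun ω : Λ → sphere (0 : E) 1 =>
      Real.exp (-(t * S (fun m => (ω m : E)))) * S (fun m => (ω m : E)) +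
        (∑ k ∈ Finset.range (K + 1), c k * t ^ k) * Real.exp (-(t * S (fun m => (ω m : E)))))
          (Measure.pi fun _ : Λ => μ) := hi1.add hi2
  rw [integral_add hi12 hi3, integral_add hi1 hi2, integral_const_mul, integral_const_mul] at h
  linarith

end Normalisation

/-! ## §3 The `log Z` reading: `mgf`, `cgf` and the tilted measure -/

section LogZ

variable [MeasurableSpace E] [BorelSpace E] [Nontrivial E]
variable {S : (Λ → E) → ℝ} {St : ℕ → (Λ → E) → ℝ} {c : ℕ → ℝ}

omit [DecidableEq Λ] in
/-- Every exponential moment of `−S` under `π̄` exists (`S` continuous, `Ω` compact):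
`integrableExpSet (−S) π̄ = ℝ`. -/
theorem integrableExpSet_neg_action_eq_univ (hS : Continuous S) :
    integrableExpSet (fun ω : Λ → sphere (0 : E) 1 => -S (fun m => (ω m : E)))
      (Measure.pi (fun _ : Λ => uniformSphere (volume : Measure E))) = univ := by
  ext t
  simp only [integrableExpSet, mem_setOf_eq, mem_univ, iff_true]
  simp_rw [mul_neg]
  exact integrable_pi_of_continuous _ (continuous_exp_neg_mul_sphereConfig hS t)

omit [DecidableEq Λ] in
/-- … so every real `t` is interior to it (the hypothesis of Mathlib's `mgf`/`cgf` calculus). -/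
theorem mem_interior_integrableExpSet_neg_action (hS : Continuous S) (t : ℝ) :
    t ∈ interior (integrableExpSet (fun ω : Λ → sphere (0 : E) 1 => -S (fun m => (ω m : E)))
      (Measure.pi (fun _ : Λ => uniformSphere (volume : Measure E)))) := by
  rw [integrableExpSet_neg_action_eq_univ hS, interior_univ]
  exact mem_univ t

omit [DecidableEq Λ] [Nontrivial E] in
/-- **`Z(t) = ∫e^{−tS}dπ̄` is the moment generating function of `−S` under `π̄`.** -/
theorem mgf_neg_action_eq (S : (Λ → E) → ℝ) (t : ℝ) :
    mgf (fun ω : Λ → sphere (0 : E) 1 => -S (fun m => (ω m : E)))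
        (Measure.pi (fun _ : Λ => uniformSphere (volume : Measure E))) t =
      ∫ ω, Real.exp (-(t * S (fun m => ((ω : Λ → sphere (0 : E) 1) m : E))))
        ∂Measure.pi (fun _ : Λ => uniformSphere (volume : Measure E)) := by
  simp only [mgf, mul_neg]

omit [DecidableEq Λ] in
/-- **`Z′(t) = −∫e^{−tS}S dπ̄`.** -/
theorem deriv_mgf_neg_action_eq (hS : Continuous S) (t : ℝ) :
    deriv (mgf (fun ω : Λ → sphere (0 : E) 1 => -S (fun m => (ω m : E)))
        (Measure.pi (fun _ : Λ => uniformSphere (volume : Measure E)))) t =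
      -∫ ω, Real.exp (-(t * S (fun m => ((ω : Λ → sphere (0 : E) 1) m : E)))) *
          S (fun m => (ω m : E)) ∂Measure.pi (fun _ : Λ => uniformSphere (volume : Measure E)) := by
  rw [deriv_mgf (mem_interior_integrableExpSet_neg_action hS t), ← integral_neg]
  refine integral_congr_ae (ae_of_all _ fun ω => ?_)
  simp only [mul_neg]
  ring

/-- **`Ċ_t^{≤K}·Z(t) = Z′(t) − t^{K+1}R_K(t)`**: Lüscher's normalisation identity through the moment
generating function `Z = mgf(−S)` of the action under `π̄`. -/
theorem luscher_normalization_truncated_mgf (hS : ContDiff ℝ 1 S) (hSt : ∀ k, ContDiff ℝ 2 (St k))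
    (h0 : ∀ ξ : Λ → sphere (0 : E) 1,
      -∑ n, siteLaplacian n (St 0) (fun m => (ξ m : E)) = S (fun m => (ξ m : E)) + c 0)
    (hs : ∀ k, ∀ ξ : Λ → sphere (0 : E) 1,
      -∑ n, siteLaplacian n (St (k + 1)) (fun m => (ξ m : E)) =
        -(∑ n, ⟪siteGrad n S (fun m => (ξ m : E)), siteGrad n (St k) (fun m => (ξ m : E))⟫) +
          c (k + 1))
    (t : ℝ) (K : ℕ) :
    (∑ k ∈ Finset.range (K + 1), c k * t ^ k) *
        mgf (fun ω : Λ → sphere (0 : E) 1 => -S (fun m => (ω m : E)))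
          (Measure.pi (fun _ : Λ => uniformSphere (volume : Measure E))) t =
      deriv (mgf (fun ω : Λ → sphere (0 : E) 1 => -S (fun m => (ω m : E)))
          (Measure.pi (fun _ : Λ => uniformSphere (volume : Measure E)))) t -
        t ^ (K + 1) * ∫ ω, Real.exp (-(t * S (fun m => ((ω : Λ → sphere (0 : E) 1) m : E)))) *
          ∑ n, ⟪siteGrad n S (fun m => (ω m : E)), siteGrad n (St K) (fun m => (ω m : E))⟫
            ∂Measure.pi (fun _ : Λ => uniformSphere (volume : Measure E)) := by
  rw [mgf_neg_action_eq, deriv_mgf_neg_action_eq hS.continuous,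
    luscher_normalization_truncated hS hSt h0 hs t K]

/-- **`Ċ_t^{≤K} = (log Z)′(t) − t^{K+1}R_K(t)/Z(t)`**: the truncated constant series IS the
logarithmic derivative of `Z(t) = ∫e^{−tS}dπ̄` (Mathlib's cumulant generating function `cgf(−S)`) up
to the explicit truncation defect — Lüscher's `C_t = ln⟨e^{−tS}⟩` (4.10), to all orders. -/
theorem luscher_normalization_truncated_cgf (hS : ContDiff ℝ 1 S) (hSt : ∀ k, ContDiff ℝ 2 (St k))
    (h0 : ∀ ξ : Λ → sphere (0 : E) 1,
      -∑ n, siteLaplacian n (St 0) (fun m => (ξ m : E)) = S (fun m => (ξ m : E)) + c 0)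
    (hs : ∀ k, ∀ ξ : Λ → sphere (0 : E) 1,
      -∑ n, siteLaplacian n (St (k + 1)) (fun m => (ξ m : E)) =
        -(∑ n, ⟪siteGrad n S (fun m => (ξ m : E)), siteGrad n (St k) (fun m => (ξ m : E))⟫) +
          c (k + 1))
    (t : ℝ) (K : ℕ) :
    ∑ k ∈ Finset.range (K + 1), c k * t ^ k =
      deriv (cgf (fun ω : Λ → sphere (0 : E) 1 => -S (fun m => (ω m : E)))
          (Measure.pi (fun _ : Λ => uniformSphere (volume : Measure E)))) t -
        t ^ (K + 1) * (∫ ω, Real.exp (-(t * S (fun m => ((ω : Λ → sphere (0 : E) 1) m : E)))) *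
            ∑ n, ⟪siteGrad n S (fun m => (ω m : E)), siteGrad n (St K) (fun m => (ω m : E))⟫
              ∂Measure.pi (fun _ : Λ => uniformSphere (volume : Measure E))) /
          ∫ ω, Real.exp (-(t * S (fun m => ((ω : Λ → sphere (0 : E) 1) m : E))))
            ∂Measure.pi (fun _ : Λ => uniformSphere (volume : Measure E)) := by
  have hZ := integral_exp_neg_mul_pos (Λ := Λ) (E := E) hS.continuous t
  have hmem := mem_interior_integrableExpSet_neg_action (Λ := Λ) (E := E) hS.continuous t
  rw [deriv_cgf hmem, ← deriv_mgf hmem, deriv_mgf_neg_action_eq hS.continuous t, mgf_neg_action_eq,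
    ← sub_div, eq_div_iff hZ.ne']
  exact luscher_normalization_truncated hS hSt h0 hs t K

/-- **LÜSCHER'S (4.9) FOR AN EXACT FLOW ACTION: `Ċ_t = (d/dt) log∫e^{−tS}dπ̄`.**  If a `C²` functional
`F` solves the flow equation `𝓛_tF = S + C` EXACTLY on `Ω` at some real `t`, then its constant is the
logarithmic derivative of `Z` at `t`: `C = (cgf(−S))′(t)` — no series, no truncation. -/
theorem sphereLuscherL_flow_constant_eq_deriv_cgf (hS : ContDiff ℝ 1 S) {F : (Λ → E) → ℝ}
    (hF : ContDiff ℝ 2 F) {t C : ℝ}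
    (h : ∀ ω : Λ → sphere (0 : E) 1,
      sphereLuscherL S t F (fun m => (ω m : E)) = S (fun m => (ω m : E)) + C) :
    C = deriv (cgf (fun ω : Λ → sphere (0 : E) 1 => -S (fun m => (ω m : E)))
      (Measure.pi (fun _ : Λ => uniformSphere (volume : Measure E)))) t := by
  have hmem := mem_interior_integrableExpSet_neg_action (Λ := Λ) (E := E) hS.continuous t
  rw [deriv_cgf hmem, ← deriv_mgf hmem, deriv_mgf_neg_action_eq hS.continuous t, mgf_neg_action_eq]
  exact sphereLuscherL_constant_eq_div hS hF hS.continuous h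

omit [DecidableEq Λ] [Nontrivial E] in
/-- Means under the tilted probability measure `μ_t = e^{−tS}π̄/Z(t)` are ratios of `π̄`-integrals. -/
theorem integral_tilted_neg_action (S : (Λ → E) → ℝ) (t : ℝ) (g : (Λ → sphere (0 : E) 1) → ℝ) :
    ∫ ω, g ω ∂(Measure.pi (fun _ : Λ => uniformSphere (volume : Measure E))).tilted
        (fun ω => -(t * S (fun m => (ω m : E)))) =
      (∫ ω, Real.exp (-(t * S (fun m => ((ω : Λ → sphere (0 : E) 1) m : E)))) * g ω
          ∂Measure.pi (fun _ : Λ => uniformSphere (volume : Measure E))) /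
        ∫ ω, Real.exp (-(t * S (fun m => ((ω : Λ → sphere (0 : E) 1) m : E))))
          ∂Measure.pi (fun _ : Λ => uniformSphere (volume : Measure E)) := by
  rw [integral_tilted, ← integral_div]
  refine integral_congr_ae (ae_of_all _ fun ω => ?_)
  simp only [smul_eq_mul]
  ring

/-- **LÜSCHER'S EQ. (4.9) AT FLOW TIME `t`, VERBATIM, WITH THE TRUNCATION DEFECT AS THE ONLY ERROR**:
`Σ_{k≤K} ċ_k t^k = −⟨S⟩_t − t^{K+1}·⟨Σ_n⟪∂̃_nS, ∂̃_nS̃⁽ᴷ⁾⟫⟩_t`, means under the tilted probability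
measure `μ_t = e^{−tS}π̄/Z(t)`; for every `C¹` action, every `C²` Lüscher series, every real `t` and
every `K`. -/
theorem luscher_normalization_truncated_tilted (hS : ContDiff ℝ 1 S)
    (hSt : ∀ k, ContDiff ℝ 2 (St k))
    (h0 : ∀ ξ : Λ → sphere (0 : E) 1,
      -∑ n, siteLaplacian n (St 0) (fun m => (ξ m : E)) = S (fun m => (ξ m : E)) + c 0)
    (hs : ∀ k, ∀ ξ : Λ → sphere (0 : E) 1,
      -∑ n, siteLaplacian n (St (k + 1)) (fun m => (ξ m : E)) =
        -(∑ n, ⟪siteGrad n S (fun m => (ξ m : E)), siteGrad n (St k) (fun m => (ξ m : E))⟫) +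
          c (k + 1))
    (t : ℝ) (K : ℕ) :
    ∑ k ∈ Finset.range (K + 1), c k * t ^ k =
      -(∫ ω, S (fun m => ((ω : Λ → sphere (0 : E) 1) m : E))
          ∂(Measure.pi (fun _ : Λ => uniformSphere (volume : Measure E))).tilted
            (fun ω => -(t * S (fun m => (ω m : E))))) -
        t ^ (K + 1) * ∫ ω, ∑ n, ⟪siteGrad n S (fun m => ((ω : Λ → sphere (0 : E) 1) m : E)),
            siteGrad n (St K) (fun m => (ω m : E))⟫
          ∂(Measure.pi (fun _ : Λ => uniformSphere (volume : Measure E))).tilted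
            (fun ω => -(t * S (fun m => (ω m : E)))) := by
  have hZ := integral_exp_neg_mul_pos (Λ := Λ) (E := E) hS.continuous t
  rw [integral_tilted_neg_action, integral_tilted_neg_action, ← neg_div, ← mul_div_assoc, ← sub_div,
    eq_div_iff hZ.ne']
  exact luscher_normalization_truncated hS hSt h0 hs t K

end LogZ

end Summit.Ventures.LatticeQCDFlow.Exactness

end
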